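import Literature.AlgebraicGeometry.AbelianSchemes.AbelianSchemeFiniteSubgroupTorsion
import Mathlib.AlgebraicGeometry.Morphisms.Etale
import HarnessLib

/-!
# Morphisms from an infinitesimal scheme to an unramified group scheme are trivial

Topic `Literature/AlgebraicGeometry/GroupSchemes`; namespace `Literature.AlgebraicGeometry.GroupSchemes`.
THEOREMS ONLY (no definition, no named fact, no instance, no notation, no `sorry`).  Cell `hodgecm-mathlib`
(D-0151), FLOOR 0, P6 «MOD programme» (crux hLiu418 = stmt-HodgeConjecture-24832), generic organ **(E1′)
«INFINITESIMAL → UNRAMIFIED IS TRIVIAL»** — the engine listed as missing (E1) in the census of the DICT organ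
(o-c3g) «an isogeny with étale kernel is an isomorphism on Frobenius kernels» (`ker φ ∩ ker Fⁿ = 1` when `ker φ`
is étale) and the HEART letter (c3b)∕(b) «the connected part of a finite group scheme meets an étale subgroup
trivially ∕ a one-point étale group scheme is trivial» (the converse direction of ★
`EtaleOfTrivialUnitComponent`).  HC_CM is proved only modulo the printed citations until rung 0 closes; this file
is generic algebraic geometry and changes no count.

THE PRINT.  [EGAIV4] Cor. (17.4.2): a morphism locally of finite type is unramified iff its diagonal is an open
immersion; hence a SECTION of an unramified morphism is an open immersion (★
`Literature.AlgebraicGeometry.AbelianSchemes.isOpenImmersion_left_of_section`, [GortzWedhorn2023] Prop. 27.13∕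
27.86 «the unit section of an unramified group scheme is open»).  Consequence ([Tate1997FiniteFlatGroupSchemes]
(3.7); [MumfordAV1970] §11 and §14 «a finite group scheme over a field `k` is étale iff its connected component
`G⁰` is trivial; there are no non-trivial homomorphisms from a connected (infinitesimal) group scheme to an étale
one»): if `K` is INFINITESIMAL — its unit section is surjective on points, e.g. `K` has one point — then every
morphism `f : K → E` into an UNRAMIFIED `S`-group scheme `E` with `η_K ≫ f = η_E` lands, point by point, in the
open subscheme `η_E(S) ⊆ E`, so it factors through the open immersion `η_E` (Mathlib `IsOpenImmersion.lift`),
and the factorisation is forced to be the structure map: `f = (K → S) ≫ η_E` is the trivial homomorphism.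
Applied to `f = 𝟙_K` for `K` itself unramified: `η_K` is an isomorphism, i.e. an infinitesimal unramified
group scheme is trivial.

* §1 (any base `S`) `eq_toUnit_comp_of_range_subset` — an `S`-morphism into an unramified `S`-scheme whose
  image lies in a section is that section composed with the structure map.
* §2 (any base, monoid objects of `Over S`) `hom_eq_toUnit_comp_unit_of_unit_surjective` («Hom(infinitesimal,
  unramified) = 1»), `isIso_unit_of_unit_surjective` («infinitesimal + unramified ⇒ trivial»).
* §3 (any base, ONE-POINT source `Subsingleton K.left`) `unit_left_surjective_of_subsingleton`,
  `hom_eq_toUnit_comp_unit_of_subsingleton`, `isIso_unit_of_subsingleton`, and the consumer shape of (E1)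
  `isIso_unit_of_subsingleton_of_hom` («a one-point group scheme admitting an unramified homomorphism — e.g. a
  closed subgroup — into an unramified group scheme is trivial»), with the étale∕closed-immersion wrappers
  `hom_eq_toUnit_comp_unit_of_subsingleton_of_etale`, `isIso_unit_of_subsingleton_of_isClosedImmersion_of_etale`.

FALSE VARIANTS (why the hypotheses): without «unramified» the unit section need not be open (`α_p`, `μ_p` over a
field of characteristic `p` are one-point group schemes with `η` not an isomorphism, and `Frobenius : α_p → α_p`
is a non-trivial endomorphism of a one-point group); without «infinitesimal» nothing is trivial (`ℤ∕2 → ℤ∕2`,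
both étale).

## References
* [EGAIV4] A. Grothendieck, J. Dieudonné, *EGA IV₄* (1967), Cor. (17.4.2).
* [GortzWedhorn2023] U. Görtz, T. Wedhorn, *Algebraic Geometry II* (2023), Prop. 27.86 (p. 633).
* [Tate1997FiniteFlatGroupSchemes] J. Tate, *Finite flat group schemes* (1997), (3.7).
* [MumfordAV1970] D. Mumford, *Abelian Varieties* (1970), §11 (p. 101), §14.
-/

set_option autoImplicit false

open CategoryTheory CategoryTheory.Limits AlgebraicGeometry MonoidalCategory CartesianMonoidalCategory

open scoped MonObj

namespace Literature.AlgebraicGeometry.GroupSchemes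

universe u

variable {S : Scheme.{u}}

/-! ## §1 Morphisms into an unramified `S`-scheme landing in a section -/

section AnyBase

variable {K E : Over S}

/-- **An `S`-morphism into an UNRAMIFIED `S`-scheme whose image lies in a section IS that section** (preceded by
the structure map): for `E → S` formally unramified and locally of finite type, a section `e : S → E` is an open
immersion (★ `isOpenImmersion_left_of_section`, [EGAIV4] (17.4.2)); an `S`-morphism `f : K → E` with
`f(K) ⊆ e(S)` lifts through it (Mathlib `IsOpenImmersion.lift`), and composing with `E → S` shows the lift is
the structure map `K → S`, i.e. `f = toUnit K ≫ e` in `Over S`. [cite: EGAIV4, Cor. (17.4.2)]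
[cite: GortzWedhorn2023, Prop. 27.86 (p. 633)] -/
theorem eq_toUnit_comp_of_range_subset [FormallyUnramified E.hom] [LocallyOfFiniteType E.hom]
    (e : 𝟙_ (Over S) ⟶ E) (f : K ⟶ E) (h : Set.range f.left ⊆ Set.range e.left) :
    f = toUnit K ≫ e := by
  haveI : IsOpenImmersion e.left := AbelianSchemes.isOpenImmersion_left_of_section e
  -- lift `f.left` through the open immersion `e.left`
  have hl : IsOpenImmersion.lift e.left f.left h ≫ e.left = f.left := IsOpenImmersion.lift_fac _ _ _
  have hw : IsOpenImmersion.lift e.left f.left h ≫ (𝟙_ (Over S)).hom = K.hom := by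
    rw [← Over.w e, ← Category.assoc, hl, Over.w f]
  -- the lift, as a morphism to the terminal object of `Over S`, is `toUnit K`
  have hu : Over.homMk (IsOpenImmersion.lift e.left f.left h) hw = toUnit K := toUnit_unique _ _
  rw [← hu]
  ext1
  rw [Over.comp_left]
  exact hl.symm

end AnyBase

/-! ## §2 Monoid objects: infinitesimal source, unramified target -/

section Monoid

variable {K E : Over S} [MonObj K] [MonObj E]

/-- **«Hom(infinitesimal, unramified) = 1».**  Let `K`, `E` be monoid objects of `Over S` (e.g. group schemes
over `S`) with `E → S` formally unramified and locally of finite type (e.g. étale), and suppose the unit section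
`η_K : S → K` is SURJECTIVE ON POINTS (`K` is infinitesimal over `S`).  Then every morphism `f : K → E`
compatible with the units (`η_K ≫ f = η_E`, e.g. a homomorphism) is the trivial one, `f = toUnit K ≫ η_E`:
each point of `K` is `η_K(s)` and is sent to `η_E(s)`, so `f(K) ⊆ η_E(S)` and §1 applies.
[cite: Tate1997FiniteFlatGroupSchemes, (3.7)] [cite: MumfordAV1970, §11 (p. 101) and §14] -/
theorem hom_eq_toUnit_comp_unit_of_unit_surjective [FormallyUnramified E.hom] [LocallyOfFiniteType E.hom]
    (f : K ⟶ E) (hf : η[K] ≫ f = η[E])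
    (hK : ∀ x : K.left, x ∈ Set.range (η[K] : 𝟙_ (Over S) ⟶ K).left) :
    f = toUnit K ≫ η[E] := by
  refine eq_toUnit_comp_of_range_subset η[E] f ?_
  rintro _ ⟨x, rfl⟩
  obtain ⟨s, rfl⟩ := hK x
  refine ⟨s, ?_⟩
  rw [← Scheme.Hom.comp_apply, ← Over.comp_left, hf]

/-- The same for a monoid homomorphism `f` (`IsMonHom f` supplies `η_K ≫ f = η_E`).
[cite: Tate1997FiniteFlatGroupSchemes, (3.7)] -/
theorem hom_eq_toUnit_comp_unit_of_unit_surjective' [FormallyUnramified E.hom] [LocallyOfFiniteType E.hom]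
    (f : K ⟶ E) [IsMonHom f]
    (hK : ∀ x : K.left, x ∈ Set.range (η[K] : 𝟙_ (Over S) ⟶ K).left) :
    f = toUnit K ≫ η[E] :=
  hom_eq_toUnit_comp_unit_of_unit_surjective f (IsMonHom.one_hom f) hK

/-- **An infinitesimal UNRAMIFIED monoid object is trivial**: if `K → S` is formally unramified and locally of
finite type and its unit section is surjective on points, then `η_K : 𝟙 ⟶ K` is an ISOMORPHISM in `Over S`
(§2 applied to `f = 𝟙_K`: `𝟙_K = toUnit K ≫ η_K`, and `η_K ≫ toUnit K = 𝟙` as `𝟙_ (Over S)` is terminal).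
[cite: Tate1997FiniteFlatGroupSchemes, (3.7)] [cite: MumfordAV1970, §11 (p. 101)] -/
theorem isIso_unit_of_unit_surjective [FormallyUnramified K.hom] [LocallyOfFiniteType K.hom]
    (hK : ∀ x : K.left, x ∈ Set.range (η[K] : 𝟙_ (Over S) ⟶ K).left) :
    IsIso (η[K] : 𝟙_ (Over S) ⟶ K) := by
  have h : 𝟙 K = toUnit K ≫ η[K] :=
    hom_eq_toUnit_comp_unit_of_unit_surjective (𝟙 K) (Category.comp_id _) hK
  exact ⟨⟨toUnit K, toUnit_unique _ _, h.symm⟩⟩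

/-- Underlying-scheme form: under the hypotheses of `isIso_unit_of_unit_surjective` the unit section
`η_K.left : S → K.left` is an isomorphism of schemes. [cite: Tate1997FiniteFlatGroupSchemes, (3.7)] -/
theorem isIso_unit_left_of_unit_surjective [FormallyUnramified K.hom] [LocallyOfFiniteType K.hom]
    (hK : ∀ x : K.left, x ∈ Set.range (η[K] : 𝟙_ (Over S) ⟶ K).left) :
    IsIso (η[K] : 𝟙_ (Over S) ⟶ K).left := by
  haveI := isIso_unit_of_unit_surjective hK
  exact inferInstanceAs (IsIso ((Over.forget S).map η[K]))

end Monoid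

/-! ## §3 One-point source (`Subsingleton K.left`) -/

section OnePoint

variable {K E : Over S} [MonObj K]

/-- A monoid object of `Over S` whose underlying scheme has AT MOST ONE POINT has unit section surjective on
points: the point `x` equals `η_K (K.hom x)`. [cite: Tate1997FiniteFlatGroupSchemes, (3.7)] -/
theorem unit_left_surjective_of_subsingleton [Subsingleton K.left] (x : K.left) :
    x ∈ Set.range (η[K] : 𝟙_ (Over S) ⟶ K).left :=
  ⟨K.hom x, Subsingleton.elim _ _⟩

/-- **«Hom(one-point, unramified) = 1».**  A unit-compatible morphism from a ONE-POINT monoid object `K` of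
`Over S` to a monoid object `E` with `E → S` formally unramified and locally of finite type is trivial:
`f = toUnit K ≫ η_E`. [cite: Tate1997FiniteFlatGroupSchemes, (3.7)] [cite: MumfordAV1970, §11 (p. 101) and §14] -/
theorem hom_eq_toUnit_comp_unit_of_subsingleton [MonObj E] [Subsingleton K.left] [FormallyUnramified E.hom]
    [LocallyOfFiniteType E.hom] (f : K ⟶ E) (hf : η[K] ≫ f = η[E]) : f = toUnit K ≫ η[E] :=
  hom_eq_toUnit_comp_unit_of_unit_surjective f hf unit_left_surjective_of_subsingleton

/-- **A one-point UNRAMIFIED monoid object is trivial**: `K → S` formally unramified and locally of finite type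
with `K.left` a one-point space ⟹ `η_K` is an isomorphism. [cite: Tate1997FiniteFlatGroupSchemes, (3.7)]
[cite: MumfordAV1970, §11 (p. 101)] -/
theorem isIso_unit_of_subsingleton [Subsingleton K.left] [FormallyUnramified K.hom]
    [LocallyOfFiniteType K.hom] : IsIso (η[K] : 𝟙_ (Over S) ⟶ K) :=
  isIso_unit_of_unit_surjective unit_left_surjective_of_subsingleton

/-- **(E1) A one-point monoid object admitting an UNRAMIFIED morphism into an unramified one is trivial.**  If
`i : K → E` over `S` has `i.left` formally unramified and locally of finite type (e.g. a closed immersion: `K` a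
closed submonoid∕subgroup scheme of `E`), `E → S` is formally unramified and locally of finite type (e.g. étale),
and `K.left` has one point, then `η_K` is an isomorphism — `K → S = i.left ≫ (E → S)` is itself unramified and
locally of finite type.  (For (o-c3g): `K = ker ψ ⊆ ker φ ∩ ker Fⁿ_A` is a closed subgroup of the étale `ker φ`
and of the one-point `ker Fⁿ_A`.) [cite: Tate1997FiniteFlatGroupSchemes, (3.7)] [cite: MumfordAV1970, §14] -/
theorem isIso_unit_of_subsingleton_of_hom [Subsingleton K.left] (i : K ⟶ E) [FormallyUnramified i.left]
    [LocallyOfFiniteType i.left] [FormallyUnramified E.hom] [LocallyOfFiniteType E.hom] :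
    IsIso (η[K] : 𝟙_ (Over S) ⟶ K) := by
  haveI : FormallyUnramified K.hom := by
    rw [← Over.w i]; exact MorphismProperty.comp_mem _ _ _ ‹_› ‹_›
  haveI : LocallyOfFiniteType K.hom := by
    rw [← Over.w i]; infer_instance
  exact isIso_unit_of_subsingleton

/-! ### Étale ∕ closed-immersion wrappers (the instances consumers hold) -/

/-- «Hom(one-point, ÉTALE) = 1»: a unit-compatible morphism from a one-point monoid object to an ÉTALE one is
trivial. [cite: Tate1997FiniteFlatGroupSchemes, (3.7)] [cite: MumfordAV1970, §14] -/
theorem hom_eq_toUnit_comp_unit_of_subsingleton_of_etale [MonObj E] [Subsingleton K.left] [Etale E.hom] (f : K ⟶ E)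
    (hf : η[K] ≫ f = η[E]) : f = toUnit K ≫ η[E] :=
  hom_eq_toUnit_comp_unit_of_subsingleton f hf

/-- **A one-point closed submonoid∕subgroup scheme of an ÉTALE monoid object is trivial**: `i : K → E` a
morphism over `S` with `i.left` a closed immersion, `E → S` étale, `K.left` one point ⟹ `η_K` is an isomorphism
(and so is `η_K.left`). [cite: Tate1997FiniteFlatGroupSchemes, (3.7)] [cite: MumfordAV1970, §14] -/
theorem isIso_unit_of_subsingleton_of_isClosedImmersion_of_etale [Subsingleton K.left] (i : K ⟶ E)
    [IsClosedImmersion i.left] [Etale E.hom] :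
    IsIso (η[K] : 𝟙_ (Over S) ⟶ K) ∧ IsIso (η[K] : 𝟙_ (Over S) ⟶ K).left := by
  haveI := isIso_unit_of_subsingleton_of_hom i
  exact ⟨‹_›, inferInstanceAs (IsIso ((Over.forget S).map η[K]))⟩

end OnePoint

end Literature.AlgebraicGeometry.GroupSchemes
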